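import Mathlib
import Literature.Analysis.FluidPDE.TurbWave0
import Literature.Analysis.FluidPDE.TimeAverageMeasureBasic
import Literature.Analysis.FluidPDE.TimeAverageMeasureExistence
import HarnessLib

/-!
# The power identity for a lag kernel (stub F4), part A: finite-horizon calculus

Crux `LimitingAbsorption.FloorUpgrade` (stmt-AnomalousDissipation-15010), line `SketchIdeator1`,
stub `stub_powerIdentity`. PURE TIME-AVERAGE ANALYSIS, no PDE. For a jointly continuous lag
kernel `K τ t` (lag `τ ≥ 0`, base time `t ≥ 0`) and the accumulated response
`p(t) = ∫₀ᵗ K(τ, t - τ) dτ` this file provides the finite-horizon identities and estimates: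

* `PowerIdentity.fubini_triangle`: `∫₀ᵀ p = ∫₀ᵀ (∫₀^{T-τ} K(τ, s) ds) dτ` (Fubini on the triangle
  `0 < τ < t ≤ T` and the substitution `s = t - τ`);
* `PowerIdentity.abs_integral_sub_riemannSum_le`: left Riemann sums of a function with
  oscillation `≤ L` on the cells `[kη, (k+1)η]`;
* `PowerIdentity.integral_Ioi_const_mul_exp_neg` and integrability of `B e^{-βτ}` on half-lines;
* `PowerIdentity.abs_timeMean_sub_sum_le`: the finite-horizon estimate
  `|T⁻¹∫₀ᵀ p - ∑_{k<N} η T⁻¹∫₀ᵀ K(kη, ·)| ≤ τ₀ |W| η + T⁻¹ B τ₀² + (B/β) e^{-βτ₀}` (`η = τ₀/N`,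
  `T ≥ max(T₀, τ₀)`, `T > 0`) under the bound `|K τ t| ≤ B e^{-βτ}` and the Cesàro-Lipschitz
  hypothesis `|T⁻¹∫₀ᵀ K(τ', ·) - T⁻¹∫₀ᵀ K(τ, ·)| ≤ W (τ' - τ)` (`0 ≤ τ ≤ τ' ≤ T`, `T ≥ T₀`).

Part B (`…StubPowerIdentity.lean`) applies the generalized limit `Λ` and compares with
`∫₀^∞ Λ-avg K(τ, ·) dτ`.
-/

set_option linter.dupNamespace false

noncomputable section

open MeasureTheory Set Filter Topology
open scoped BigOperators

namespace Summit.AnomalousDissipation.AnomalousDissipation.Theorems.FloorUpgradeLine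

namespace PowerIdentity

open Literature.Analysis.FluidPDE

variable {K : ℝ → ℝ → ℝ} {B β : ℝ}

/-! ### Fubini on the triangle -/

/-- **Fubini on the triangle** `0 < τ < t ≤ T` followed by the substitution `s = t - τ`:
`∫₀ᵀ (∫₀ᵗ K(τ, t - τ) dτ) dt = ∫₀ᵀ (∫₀^{T-τ} K(τ, s) ds) dτ` for a jointly continuous `K`
(the cut-off integrand `1_{τ < t} K(τ, t - τ)` is bounded and measurable on the
square). [folklore] -/
theorem fubini_triangle (hcont : Continuous (Function.uncurry K)) {T : ℝ} (hT : 0 ≤ T) :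
    ∫ t in (0 : ℝ)..T, (∫ τ in (0 : ℝ)..t, K τ (t - τ)) =
      ∫ τ in (0 : ℝ)..T, ∫ s in (0 : ℝ)..(T - τ), K τ s := by
  -- the integrand on the square, cut off to the triangle `τ < t`
  set F : ℝ → ℝ → ℝ := fun t τ =>
    ({z : ℝ × ℝ | z.2 < z.1}).indicator (fun z => K z.2 (z.1 - z.2)) (t, τ) with hF
  have hG : Continuous fun z : ℝ × ℝ => K z.2 (z.1 - z.2) :=
    hcont.comp (continuous_snd.prodMk (continuous_fst.sub continuous_snd))
  have hFi : Integrable (Function.uncurry F)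
      ((volume.restrict (Ioc 0 T)).prod (volume.restrict (Ioc 0 T))) := by
    rw [Measure.prod_restrict, ← Measure.volume_eq_prod]
    have hunc : Function.uncurry F =
        ({z : ℝ × ℝ | z.2 < z.1}).indicator (fun z => K z.2 (z.1 - z.2)) := by
      funext z
      rfl
    rw [hunc]
    refine Integrable.indicator ?_ (measurableSet_lt measurable_snd measurable_fst)
    have h : IntegrableOn (fun z : ℝ × ℝ => K z.2 (z.1 - z.2)) (Icc 0 T ×ˢ Icc 0 T) volume :=
      hG.continuousOn.integrableOn_compact (isCompact_Icc.prod isCompact_Icc)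
    exact h.mono_set (prod_mono Ioc_subset_Icc_self Ioc_subset_Icc_self)
  have hswap := integral_integral_swap hFi
  rw [intervalIntegral.integral_of_le hT, intervalIntegral.integral_of_le hT]
  have hL : EqOn (fun t => ∫ τ in (0 : ℝ)..t, K τ (t - τ)) (fun t => ∫ τ in Ioc 0 T, F t τ)
      (Ioc 0 T) := by
    intro t ht
    simp only
    have h1 : (fun τ => F t τ) = (Iio t).indicator (fun τ => K τ (t - τ)) := by
      funext τ
      by_cases h : τ < t
      · simp [hF, Set.indicator_apply, h]
      · simp [hF, Set.indicator_apply, h]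
    rw [h1, setIntegral_indicator measurableSet_Iio]
    have h2 : Ioc 0 T ∩ Iio t = Ioo 0 t := by
      ext τ
      simp only [mem_inter_iff, mem_Ioc, mem_Iio, mem_Ioo]
      constructor
      · rintro ⟨⟨h0, -⟩, h3⟩
        exact ⟨h0, h3⟩
      · rintro ⟨h0, h3⟩
        exact ⟨⟨h0, h3.le.trans ht.2⟩, h3⟩
    rw [h2, ← integral_Ioc_eq_integral_Ioo, intervalIntegral.integral_of_le ht.1.le]
  have hR : EqOn (fun τ => ∫ s in (0 : ℝ)..(T - τ), K τ s) (fun τ => ∫ t in Ioc 0 T, F t τ)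
      (Ioc 0 T) := by
    intro τ hτ
    simp only
    have h1 : (fun t => F t τ) = (Ioi τ).indicator (fun t => K τ (t - τ)) := by
      funext t
      by_cases h : τ < t
      · simp [hF, Set.indicator_apply, h]
      · simp [hF, Set.indicator_apply, h]
    rw [h1, setIntegral_indicator measurableSet_Ioi]
    have h2 : Ioc 0 T ∩ Ioi τ = Ioc τ T := by
      ext t
      simp only [mem_inter_iff, mem_Ioc, mem_Ioi]
      constructor
      · rintro ⟨⟨-, h3⟩, h4⟩
        exact ⟨h4, h3⟩
      · rintro ⟨h4, h3⟩
        exact ⟨⟨hτ.1.trans h4, h3⟩, h4⟩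
    rw [h2, ← intervalIntegral.integral_of_le hτ.2,
      intervalIntegral.integral_comp_sub_right (fun s => K τ s) τ, sub_self]
  rw [setIntegral_congr_fun measurableSet_Ioc hL, setIntegral_congr_fun measurableSet_Ioc hR]
  exact hswap

/-! ### Left Riemann sums -/

/-- **Left Riemann sums.** If `f` is interval integrable and oscillates by at most `L` on each
cell `[kη, (k+1)η]`, `k < N`, then `|∫₀^{Nη} f - ∑_{k<N} η f(kη)| ≤ N η L`. [folklore] -/
theorem abs_integral_sub_riemannSum_le {f : ℝ → ℝ} {η L : ℝ} (hη : 0 ≤ η)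
    (hint : ∀ a b, IntervalIntegrable f volume a b) :
    ∀ N : ℕ, (∀ k : ℕ, k < N → ∀ τ, (k : ℝ) * η ≤ τ → τ ≤ ((k : ℝ) + 1) * η →
      |f τ - f (k * η)| ≤ L) →
    |(∫ τ in (0 : ℝ)..(N * η), f τ) - ∑ k ∈ Finset.range N, η * f (k * η)| ≤ N * η * L := by
  intro N
  induction N with
  | zero =>
    intro _
    simp
  | succ N ih =>
    intro hosc
    have ih' := ih fun k hk => hosc k (Nat.lt_succ_of_lt hk)
    have hle : (N : ℝ) * η ≤ ((N : ℝ) + 1) * η := by nlinarith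
    have hcell : |(∫ τ in ((N : ℝ) * η)..(((N : ℝ) + 1) * η), f τ) - η * f (N * η)| ≤ η * L := by
      have h1 : (∫ τ in ((N : ℝ) * η)..(((N : ℝ) + 1) * η), f τ) - η * f (N * η) =
          ∫ τ in ((N : ℝ) * η)..(((N : ℝ) + 1) * η), (f τ - f (N * η)) := by
        rw [intervalIntegral.integral_sub (hint _ _) intervalIntegrable_const,
          intervalIntegral.integral_const, smul_eq_mul]
        ring
      rw [h1]
      have h2 : ‖∫ τ in ((N : ℝ) * η)..(((N : ℝ) + 1) * η), (f τ - f (N * η))‖ ≤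
          L * |((N : ℝ) + 1) * η - N * η| :=
        intervalIntegral.norm_integral_le_of_norm_le_const fun τ hτ => by
          rw [uIoc_of_le hle] at hτ
          rw [Real.norm_eq_abs]
          exact hosc N N.lt_succ_self τ hτ.1.le hτ.2
      rw [Real.norm_eq_abs] at h2
      calc _ ≤ L * |((N : ℝ) + 1) * η - N * η| := h2
        _ = η * L := by
          rw [show ((N : ℝ) + 1) * η - N * η = η by ring, abs_of_nonneg hη]
          ring
    push_cast
    rw [Finset.sum_range_succ, ← intervalIntegral.integral_add_adjacent_intervals
      (b := (N : ℝ) * η) (hint _ _) (hint _ _)]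
    calc |(∫ τ in (0 : ℝ)..(N * η), f τ) + (∫ τ in ((N : ℝ) * η)..((N + 1) * η), f τ) -
          (∑ k ∈ Finset.range N, η * f (k * η) + η * f (N * η))|
        = |((∫ τ in (0 : ℝ)..(N * η), f τ) - ∑ k ∈ Finset.range N, η * f (k * η)) +
            ((∫ τ in ((N : ℝ) * η)..((N + 1) * η), f τ) - η * f (N * η))| := by ring_nf
      _ ≤ N * η * L + η * L := (abs_add_le _ _).trans (add_le_add ih' hcell)
      _ = (N + 1) * η * L := by ring

/-! ### Exponential tails -/

/-- `∫_{(a, ∞)} B e^{-βx} dx = (B / β) e^{-βa}` for `β > 0`. [folklore] -/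
theorem integral_Ioi_const_mul_exp_neg (hβ : 0 < β) (B a : ℝ) :
    ∫ x in Ioi a, B * Real.exp (-(β * x)) = B / β * Real.exp (-(β * a)) := by
  have h := integral_exp_mul_Ioi (neg_neg_iff_pos.2 hβ) a
  simp only [neg_mul] at h
  rw [integral_const_mul, h]
  field_simp

/-- `B e^{-βx}` is integrable on `(a, ∞)` for `β > 0`. [folklore] -/
theorem integrableOn_Ioi_const_mul_exp_neg (hβ : 0 < β) (B a : ℝ) :
    IntegrableOn (fun x => B * Real.exp (-(β * x))) (Ioi a) := by
  have h : IntegrableOn (fun x => Real.exp (-(β * x))) (Ioi a) := by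
    simpa only [neg_mul] using exp_neg_integrableOn_Ioi a hβ
  exact h.const_mul B

/-- The bound `|K τ t| ≤ B e^{-βτ}` at `τ = t = 0` forces `0 ≤ B`. [folklore] -/
theorem nonneg_of_bound (hbd : ∀ τ t, 0 ≤ τ → 0 ≤ t → |K τ t| ≤ B * Real.exp (-(β * τ))) :
    0 ≤ B := by
  have h := hbd 0 0 le_rfl le_rfl
  simp only [mul_zero, neg_zero, Real.exp_zero, mul_one] at h
  exact (abs_nonneg _).trans h


/-! ### The finite-horizon estimate -/

variable {W T₀ : ℝ} {p : ℝ → ℝ}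

/-- **Finite-horizon estimate.** For `T > 0`, `T ≥ T₀` and `T ≥ τ₀ = Nη`:
`|T⁻¹∫₀ᵀ p - ∑_{k<N} η T⁻¹∫₀ᵀ K(kη, ·)| ≤ τ₀ |W| η + T⁻¹ B τ₀² + (B/β) e^{-βτ₀}`. By
`fubini_triangle`, `T⁻¹∫₀ᵀ p = ∫₀ᵀ m_T` with `m_T(τ) = T⁻¹ ∫₀^{T-τ} K(τ, ·)`; on `[τ₀, T]`
`|m_T(τ)| ≤ B e^{-βτ}`, on `[0, τ₀]` `|m_T(τ) - n_T(τ)| ≤ T⁻¹ B τ₀` where `n_T(τ) = T⁻¹∫₀ᵀ K(τ, ·)`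
is the Cesàro mean, whose left Riemann sum is controlled by the Cesàro-Lipschitz
hypothesis. [folklore] -/
theorem abs_timeMean_sub_sum_le (hβ : 0 < β) (hcont : Continuous (Function.uncurry K))
    (hbd : ∀ τ t, 0 ≤ τ → 0 ≤ t → |K τ t| ≤ B * Real.exp (-(β * τ)))
    (hlip : ∀ T, T₀ ≤ T → ∀ τ τ', 0 ≤ τ → τ ≤ τ' → τ' ≤ T →
      |timeMean (K τ') T - timeMean (K τ) T| ≤ W * (τ' - τ))
    (hp : ∀ t, 0 ≤ t → p t = ∫ τ in (0 : ℝ)..t, K τ (t - τ))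
    {τ₀ : ℝ} (hτ₀ : 0 < τ₀) {N : ℕ} (hN : 0 < N) {T : ℝ} (hT : 0 < T) (hT₀ : T₀ ≤ T)
    (hτ₀T : τ₀ ≤ T) :
    |timeMean p T - ∑ k ∈ Finset.range N, τ₀ / N * timeMean (K (k * (τ₀ / N))) T| ≤
      τ₀ * |W| * (τ₀ / N) + T⁻¹ * B * τ₀ ^ 2 + B / β * Real.exp (-(β * τ₀)) := by
  set η := τ₀ / N with hη
  have hNpos : (0 : ℝ) < N := Nat.cast_pos.2 hN
  have hη0 : 0 < η := div_pos hτ₀ hNpos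
  have hNη : (N : ℝ) * η = τ₀ := by rw [hη]; field_simp
  have hB : 0 ≤ B := nonneg_of_bound hbd
  -- the two lag profiles at horizon `T`
  set m : ℝ → ℝ := fun τ => T⁻¹ * ∫ s in (0 : ℝ)..(T - τ), K τ s with hm
  set n : ℝ → ℝ := fun τ => timeMean (K τ) T with hn
  show |timeMean p T - ∑ k ∈ Finset.range N, η * n (k * η)| ≤
      τ₀ * |W| * η + T⁻¹ * B * τ₀ ^ 2 + B / β * Real.exp (-(β * τ₀))
  have hm_cont : Continuous m :=
    continuous_const.mul (intervalIntegral.continuous_parametric_intervalIntegral_of_continuous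
      hcont (continuous_const.sub continuous_id))
  have hn_cont : Continuous n :=
    continuous_const.mul
      (intervalIntegral.continuous_parametric_intervalIntegral_of_continuous' hcont 0 T)
  have hmi : ∀ a b, IntervalIntegrable m volume a b := fun a b => hm_cont.intervalIntegrable a b
  have hni : ∀ a b, IntervalIntegrable n volume a b := fun a b => hn_cont.intervalIntegrable a b
  have hci : ∀ τ a b, IntervalIntegrable (fun s => K τ s) volume a b := fun τ a b =>
    (hcont.comp (continuous_const.prodMk continuous_id) : Continuous (K τ)).intervalIntegrable a b
  -- Fubini: the Cesàro mean of `p` is the lag integral of `m`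
  have hmean : timeMean p T = ∫ τ in (0 : ℝ)..T, m τ := by
    have hcongr : ∫ t in (0 : ℝ)..T, p t = ∫ t in (0 : ℝ)..T, (∫ τ in (0 : ℝ)..t, K τ (t - τ)) :=
      intervalIntegral.integral_congr fun t ht => by
        rw [uIcc_of_le hT.le] at ht
        exact hp t ht.1
    simp only [hm, timeMean]
    rw [intervalIntegral.integral_const_mul, hcongr, fubini_triangle hcont hT.le]
  -- pointwise bounds
  have hKint : ∀ τ, 0 ≤ τ → ∀ a b, 0 ≤ a → 0 ≤ b →
      |∫ s in a..b, K τ s| ≤ B * Real.exp (-(β * τ)) * |b - a| := by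
    intro τ hτ a b ha hb
    have h := intervalIntegral.norm_integral_le_of_norm_le_const (a := a) (b := b)
      (C := B * Real.exp (-(β * τ))) (f := fun s => K τ s) fun s hs => by
        rw [Real.norm_eq_abs]
        exact hbd τ s hτ ((le_min ha hb).trans hs.1.le)
    rwa [Real.norm_eq_abs] at h
  have hP1 : ∀ τ, 0 ≤ τ → τ ≤ T → |m τ| ≤ B * Real.exp (-(β * τ)) := by
    intro τ hτ hτT
    have h := hKint τ hτ 0 (T - τ) le_rfl (sub_nonneg.2 hτT)
    rw [sub_zero, abs_of_nonneg (sub_nonneg.2 hτT)] at h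
    have hE : 0 ≤ B * Real.exp (-(β * τ)) := mul_nonneg hB (Real.exp_pos _).le
    simp only [hm]
    rw [abs_mul, abs_of_pos (inv_pos.2 hT)]
    calc T⁻¹ * |∫ s in (0 : ℝ)..(T - τ), K τ s|
        ≤ T⁻¹ * (B * Real.exp (-(β * τ)) * (T - τ)) := by gcongr
      _ ≤ T⁻¹ * (B * Real.exp (-(β * τ)) * T) := by gcongr; linarith
      _ = B * Real.exp (-(β * τ)) := by field_simp
  have hP2 : ∀ τ, 0 < τ → τ ≤ τ₀ → |m τ - n τ| ≤ T⁻¹ * B * τ₀ := by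
    intro τ hτ hττ₀
    have hτT : τ ≤ T := hττ₀.trans hτ₀T
    have hdiff : m τ - n τ = T⁻¹ * ∫ s in T..(T - τ), K τ s := by
      simp only [hm, hn, timeMean]
      rw [← mul_sub, intervalIntegral.integral_interval_sub_left (hci τ 0 (T - τ)) (hci τ 0 T)]
    have h := hKint τ hτ.le T (T - τ) hT.le (sub_nonneg.2 hτT)
    rw [show T - τ - T = -τ by ring, abs_neg, abs_of_pos hτ] at h
    have hexp : Real.exp (-(β * τ)) ≤ 1 :=
      Real.exp_le_one_iff.2 (neg_nonpos.2 (mul_nonneg hβ.le hτ.le))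
    rw [hdiff, abs_mul, abs_of_pos (inv_pos.2 hT), mul_assoc]
    refine mul_le_mul_of_nonneg_left ?_ (inv_pos.2 hT).le
    calc |∫ s in T..(T - τ), K τ s| ≤ B * Real.exp (-(β * τ)) * τ := h
      _ ≤ B * 1 * τ₀ := by gcongr
      _ = B * τ₀ := by ring
  have hP3 : ∀ k : ℕ, k < N → ∀ τ, (k : ℝ) * η ≤ τ → τ ≤ ((k : ℝ) + 1) * η →
      |n τ - n (k * η)| ≤ |W| * η := by
    intro k hk τ hkτ hτk
    have hk0 : 0 ≤ (k : ℝ) * η := mul_nonneg (Nat.cast_nonneg k) hη0.le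
    have hk1 : ((k : ℝ) + 1) * η = k * η + η := by ring
    have hτT : τ ≤ T := by
      have h1 : ((k : ℝ) + 1) * η ≤ N * η := by
        have : (k : ℝ) + 1 ≤ N := by exact_mod_cast hk
        exact mul_le_mul_of_nonneg_right this hη0.le
      linarith
    have h := hlip T hT₀ (k * η) τ hk0 hkτ hτT
    calc |n τ - n (k * η)| ≤ W * (τ - k * η) := h
      _ ≤ |W| * (τ - k * η) := mul_le_mul_of_nonneg_right (le_abs_self W) (sub_nonneg.2 hkτ)
      _ ≤ |W| * η := mul_le_mul_of_nonneg_left (by linarith) (abs_nonneg W)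
  -- decomposition of the Cesàro mean of `p`
  have hsplit : timeMean p T = (∫ τ in (0 : ℝ)..τ₀, n τ) + (∫ τ in (0 : ℝ)..τ₀, (m τ - n τ)) +
      ∫ τ in τ₀..T, m τ := by
    rw [hmean, ← intervalIntegral.integral_add_adjacent_intervals (hmi 0 τ₀) (hmi τ₀ T),
      ← intervalIntegral.integral_add (hni 0 τ₀) ((hmi 0 τ₀).sub (hni 0 τ₀))]
    congr 1
    refine intervalIntegral.integral_congr fun τ _ => ?_
    ring
  -- Riemann sum of the Cesàro means
  have hR := abs_integral_sub_riemannSum_le hη0.le hni N hP3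
  rw [hNη] at hR
  -- the boundary layer `[T - τ, T]`
  have hM : |∫ τ in (0 : ℝ)..τ₀, (m τ - n τ)| ≤ T⁻¹ * B * τ₀ ^ 2 := by
    have h := intervalIntegral.norm_integral_le_of_norm_le_const (a := 0) (b := τ₀)
      (C := T⁻¹ * B * τ₀) (f := fun τ => m τ - n τ) fun τ hτ => by
        rw [uIoc_of_le hτ₀.le] at hτ
        rw [Real.norm_eq_abs]
        exact hP2 τ hτ.1 hτ.2
    rw [Real.norm_eq_abs, sub_zero, abs_of_pos hτ₀] at h
    calc _ ≤ T⁻¹ * B * τ₀ * τ₀ := h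
      _ = T⁻¹ * B * τ₀ ^ 2 := by ring
  -- the tail `[τ₀, T]`
  have hTail : |∫ τ in τ₀..T, m τ| ≤ B / β * Real.exp (-(β * τ₀)) := by
    have h1 : |∫ τ in τ₀..T, m τ| ≤ ∫ τ in τ₀..T, B * Real.exp (-(β * τ)) := by
      have h := intervalIntegral.norm_integral_le_of_norm_le (f := m)
        (g := fun τ => B * Real.exp (-(β * τ))) (μ := volume) hτ₀T
        (ae_of_all _ fun τ hτ => ?_)
        ((by fun_prop : Continuous fun τ => B * Real.exp (-(β * τ))).intervalIntegrable _ _)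
      · rwa [Real.norm_eq_abs] at h
      · rw [Real.norm_eq_abs]
        exact hP1 τ (hτ₀.le.trans hτ.1.le) hτ.2
    have h2 : ∫ τ in τ₀..T, B * Real.exp (-(β * τ)) ≤
        ∫ τ in Ioi τ₀, B * Real.exp (-(β * τ)) := by
      rw [intervalIntegral.integral_of_le hτ₀T]
      refine setIntegral_mono_set (integrableOn_Ioi_const_mul_exp_neg hβ B τ₀) ?_
        Ioc_subset_Ioi_self.eventuallyLE
      exact ae_of_all _ fun τ => mul_nonneg hB (Real.exp_pos _).le
    rw [integral_Ioi_const_mul_exp_neg hβ] at h2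
    exact h1.trans h2
  -- combine
  rw [hsplit]
  calc |(∫ τ in (0 : ℝ)..τ₀, n τ) + (∫ τ in (0 : ℝ)..τ₀, (m τ - n τ)) + (∫ τ in τ₀..T, m τ) -
        ∑ k ∈ Finset.range N, η * n (k * η)|
      = |((∫ τ in (0 : ℝ)..τ₀, n τ) - ∑ k ∈ Finset.range N, η * n (k * η)) +
          (∫ τ in (0 : ℝ)..τ₀, (m τ - n τ)) + (∫ τ in τ₀..T, m τ)| := by ring_nf
    _ ≤ |(∫ τ in (0 : ℝ)..τ₀, n τ) - ∑ k ∈ Finset.range N, η * n (k * η)| +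
          |∫ τ in (0 : ℝ)..τ₀, (m τ - n τ)| + |∫ τ in τ₀..T, m τ| := abs_add_three _ _ _
    _ ≤ τ₀ * (|W| * η) + T⁻¹ * B * τ₀ ^ 2 + B / β * Real.exp (-(β * τ₀)) :=
        add_le_add (add_le_add hR hM) hTail
    _ = τ₀ * |W| * η + T⁻¹ * B * τ₀ ^ 2 + B / β * Real.exp (-(β * τ₀)) := by ring

end PowerIdentity

/-- **Registered form (explicit binders) of `PowerIdentity.abs_timeMean_sub_sum_le`**, the
finite-horizon estimate of stub F4: for `T > 0`, `T ≥ T₀`, `T ≥ τ₀` and `N ≥ 1`,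
`|T⁻¹∫₀ᵀ p - ∑_{k<N} (τ₀/N) T⁻¹∫₀ᵀ K(kτ₀/N, ·)| ≤ τ₀ |W| τ₀/N + T⁻¹ B τ₀² + (B/β) e^{-βτ₀}`.
[folklore] -/
theorem powerIdentityA_finiteHorizon (K : ℝ → ℝ → ℝ) (p : ℝ → ℝ) (B β W T₀ : ℝ) (hβ : 0 < β)
    (hcont : Continuous (Function.uncurry K))
    (hbd : ∀ τ t, 0 ≤ τ → 0 ≤ t → |K τ t| ≤ B * Real.exp (-(β * τ)))
    (hlip : ∀ T, T₀ ≤ T → ∀ τ τ', 0 ≤ τ → τ ≤ τ' → τ' ≤ T →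
      |Literature.Analysis.FluidPDE.timeMean (K τ') T -
        Literature.Analysis.FluidPDE.timeMean (K τ) T| ≤ W * (τ' - τ))
    (hp : ∀ t, 0 ≤ t → p t = ∫ τ in (0 : ℝ)..t, K τ (t - τ)) (τ₀ : ℝ) (hτ₀ : 0 < τ₀) (N : ℕ)
    (hN : 0 < N) (T : ℝ) (hT : 0 < T) (hT₀ : T₀ ≤ T) (hτ₀T : τ₀ ≤ T) :
    |Literature.Analysis.FluidPDE.timeMean p T -
        ∑ k ∈ Finset.range N, τ₀ / N * Literature.Analysis.FluidPDE.timeMean (K (k * (τ₀ / N))) T| ≤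
      τ₀ * |W| * (τ₀ / N) + T⁻¹ * B * τ₀ ^ 2 + B / β * Real.exp (-(β * τ₀)) :=
  PowerIdentity.abs_timeMean_sub_sum_le hβ hcont hbd hlip hp hτ₀ hN hT hT₀ hτ₀T


end Summit.AnomalousDissipation.AnomalousDissipation.Theorems.FloorUpgradeLine

end
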